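import Literature.MathematicalPhysics.QuantumFieldTheory.ConstructiveQFTWave0
import Literature.Probability.LatticeModels.LatticeGraph
import Mathlib.Analysis.SpecialFunctions.Complex.Circle
import HarnessLib

/-!
# Plaquettes of Lüscher's flux-sector field and the chord bound `‖1 − e^{iθ}‖ ≤ |θ|`
# (helpers `flux_plaquette_fluxSector`, `flux_norm_one_sub_circleExp_le` of stub S11)

Helpers of the residual stub S11 `stub_periodicIndexCarrier` of line `free-volume-heavy-witness`
(reshape r4) of crux `Summit.QuantumFields.QCD.Theses.SpectralDefectExtinction.WindowExtinction`
(item stmt-QuantumFields-8964), lead c3 wave 2.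

* `flux_plaquette_fluxSector` — Lüscher's representative `U(1)` field of the flux sector `m`
  (an antisymmetric integer matrix) on the periodic four-torus `(ℤ/Lℤ)⁴`,
  `V(x,μ) = exp{ −(2πi/L²)[ L·δ_{x̃_μ,L−1}·Σ_{ν>μ} m_{μν} x̃_ν + Σ_{ν<μ} m_{μν} x̃_ν ] }`
  (`x̃_ν ∈ {0,…,L−1}` the coordinate, `ZMod.val`), has the constant field tensor
  `V(x,μ) V(x+μ̂,ν) V(x+ν̂,μ)⁻¹ V(x,ν)⁻¹ = exp(2πi m_{μν}/L²)` at every site and in every plane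
  (M. Lüscher, Nucl. Phys. B 549 (1999) 295, §7).  Proof: `Circle` is commutative, so the holonomy is
  `exp` of the signed sum of the four phases (`flux_plaquette_of_phase`, which also disposes of the
  planes `μ = ν` and `μ > ν` by antisymmetry); shifting `x` by `μ̂` changes only the coordinate
  `x̃_μ`, by `+1` off the seam `x̃_μ = L−1` and by `−(L−1)` on it, so for `μ < ν` the signed sum is
  `(2π m_{μν}/L²)·(Δ_μ + L·δ_{x̃_μ,L−1}·Δ_ν) ∈ {2π m_{μν}/L², 2π m_{μν}/L² − 2π m_{μν}}`
  (`flux_phase_plaquette`).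
* `flux_norm_one_sub_circleExp_le` — `‖1 − e^{iθ}‖ = 2|sin(θ/2)| ≤ |θ|`
  (Mathlib's `Real.norm_exp_I_mul_ofReal_sub_one_le`).
-/

noncomputable section

namespace Summit.QuantumFields.QCD.Cruxes.WindowExtinction.FreeVolumeHeavyWitness

open Literature.MathematicalPhysics Literature.MathematicalPhysics.QuantumFieldTheory
  Literature.Probability.LatticeModels
open scoped BigOperators

/-! ### Coordinates of shifted sites -/

/-- Shifting by `μ̂` does not move the other coordinates. -/
theorem flux_shift_apply_ne {L : ℕ} (x : TorusSite 4 L) {μ ρ : Fin 4} (h : ρ ≠ μ) :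
    (QuantumFieldTheory.Site.shift x μ) ρ = x ρ := by
  simp [QuantumFieldTheory.Site.shift, Pi.single_eq_of_ne h]

/-- Shifting by `μ̂` adds one to the `μ`-th coordinate. -/
theorem flux_shift_apply_self {L : ℕ} (x : TorusSite 4 L) (μ : Fin 4) :
    (QuantumFieldTheory.Site.shift x μ) μ = x μ + 1 := by
  simp [QuantumFieldTheory.Site.shift]

/-- The shifted coordinate: `(x + μ̂)~_μ = (x̃_μ + 1) mod L`. -/
theorem flux_val_shift_self {L : ℕ} [NeZero L] (x : TorusSite 4 L) (μ : Fin 4) :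
    ((QuantumFieldTheory.Site.shift x μ) μ).val = ((x μ).val + 1) % L := by
  rw [flux_shift_apply_self, ZMod.val_add, ZMod.val_one_eq_one_mod, Nat.add_mod_mod]

/-- Off the seam `x̃_μ = L − 1` the coordinate jump `Δ_μ(x) = (x + μ̂)~_μ − x̃_μ` is `+1`. -/
theorem flux_jump_of_ne {L : ℕ} [NeZero L] (x : TorusSite 4 L) (μ : Fin 4)
    (h : (x μ).val ≠ L - 1) :
    (((QuantumFieldTheory.Site.shift x μ) μ).val : ℝ) - ((x μ).val : ℝ) = 1 := by
  have hlt : (x μ).val < L := ZMod.val_lt _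
  have h1 : (x μ).val + 1 < L := by omega
  rw [flux_val_shift_self, Nat.mod_eq_of_lt h1]
  push_cast
  ring

/-- On the seam `x̃_μ = L − 1` the coordinate jump `Δ_μ(x) = (x + μ̂)~_μ − x̃_μ` is `1 − L`. -/
theorem flux_jump_of_eq {L : ℕ} [NeZero L] (x : TorusSite 4 L) (μ : Fin 4)
    (h : (x μ).val = L - 1) :
    (((QuantumFieldTheory.Site.shift x μ) μ).val : ℝ) - ((x μ).val : ℝ) = 1 - (L : ℝ) := by
  have hL : 1 ≤ L := NeZero.one_le
  have h1 : (x μ).val + 1 = L := by omega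
  rw [flux_val_shift_self, h1, Nat.mod_self, h, Nat.cast_sub hL]
  push_cast
  ring

/-! ### The two coordinate sums of the phase under the two shifts of a plaquette (`μ < ν`) -/

/-- `A_ν(x + μ̂) = A_ν(x)` for `μ < ν`: the upper sum `A_ν = Σ_{ρ>ν} m_{νρ} x̃_ρ` of direction `ν`
sees only coordinates `ρ > ν > μ`. -/
theorem flux_sumHi_shift_lo {L : ℕ} (m : Fin 4 → Fin 4 → ℤ) (x : TorusSite 4 L) {μ ν : Fin 4}
    (hμν : μ < ν) :
    (∑ ρ : Fin 4, if ν < ρ then (m ν ρ : ℝ) * (((QuantumFieldTheory.Site.shift x μ) ρ).val : ℝ)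
      else 0) = ∑ ρ : Fin 4, if ν < ρ then (m ν ρ : ℝ) * ((x ρ).val : ℝ) else 0 := by
  refine Finset.sum_congr rfl fun ρ _ => ?_
  split_ifs with h
  · rw [flux_shift_apply_ne x (ne_of_gt (lt_trans hμν h))]
  · rfl

/-- `B_μ(x + ν̂) = B_μ(x)` for `μ < ν`: the lower sum `B_μ = Σ_{ρ<μ} m_{μρ} x̃_ρ` of direction `μ`
sees only coordinates `ρ < μ < ν`. -/
theorem flux_sumLo_shift_hi {L : ℕ} (m : Fin 4 → Fin 4 → ℤ) (x : TorusSite 4 L) {μ ν : Fin 4}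
    (hμν : μ < ν) :
    (∑ ρ : Fin 4, if ρ < μ then (m μ ρ : ℝ) * (((QuantumFieldTheory.Site.shift x ν) ρ).val : ℝ)
      else 0) = ∑ ρ : Fin 4, if ρ < μ then (m μ ρ : ℝ) * ((x ρ).val : ℝ) else 0 := by
  refine Finset.sum_congr rfl fun ρ _ => ?_
  split_ifs with h
  · rw [flux_shift_apply_ne x (ne_of_lt (lt_trans h hμν))]
  · rfl

/-- `B_ν(x + μ̂) = B_ν(x) + m_{νμ} Δ_μ(x)` for `μ < ν`. -/
theorem flux_sumLo_shift_lo {L : ℕ} (m : Fin 4 → Fin 4 → ℤ) (x : TorusSite 4 L) {μ ν : Fin 4}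
    (hμν : μ < ν) :
    (∑ ρ : Fin 4, if ρ < ν then (m ν ρ : ℝ) * (((QuantumFieldTheory.Site.shift x μ) ρ).val : ℝ)
      else 0) =
      (∑ ρ : Fin 4, if ρ < ν then (m ν ρ : ℝ) * ((x ρ).val : ℝ) else 0) +
        (m ν μ : ℝ) *
          ((((QuantumFieldTheory.Site.shift x μ) μ).val : ℝ) - ((x μ).val : ℝ)) := by
  have key : ∀ ρ : Fin 4,
      (if ρ < ν then (m ν ρ : ℝ) * (((QuantumFieldTheory.Site.shift x μ) ρ).val : ℝ) else 0) =
        (if ρ < ν then (m ν ρ : ℝ) * ((x ρ).val : ℝ) else 0) +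
          if ρ = μ then (m ν μ : ℝ) *
            ((((QuantumFieldTheory.Site.shift x μ) μ).val : ℝ) - ((x μ).val : ℝ)) else 0 := by
    intro ρ
    by_cases hρ : ρ = μ
    · subst hρ
      rw [if_pos hμν, if_pos hμν, if_pos rfl]
      ring
    · rw [if_neg hρ, flux_shift_apply_ne x hρ, add_zero]
  rw [Finset.sum_congr rfl fun ρ _ => key ρ]
  simp only [Finset.sum_add_distrib, Finset.sum_ite_eq', Finset.mem_univ, if_true]

/-- `A_μ(x + ν̂) = A_μ(x) + m_{μν} Δ_ν(x)` for `μ < ν`. -/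
theorem flux_sumHi_shift_hi {L : ℕ} (m : Fin 4 → Fin 4 → ℤ) (x : TorusSite 4 L) {μ ν : Fin 4}
    (hμν : μ < ν) :
    (∑ ρ : Fin 4, if μ < ρ then (m μ ρ : ℝ) * (((QuantumFieldTheory.Site.shift x ν) ρ).val : ℝ)
      else 0) =
      (∑ ρ : Fin 4, if μ < ρ then (m μ ρ : ℝ) * ((x ρ).val : ℝ) else 0) +
        (m μ ν : ℝ) *
          ((((QuantumFieldTheory.Site.shift x ν) ν).val : ℝ) - ((x ν).val : ℝ)) := by
  have key : ∀ ρ : Fin 4,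
      (if μ < ρ then (m μ ρ : ℝ) * (((QuantumFieldTheory.Site.shift x ν) ρ).val : ℝ) else 0) =
        (if μ < ρ then (m μ ρ : ℝ) * ((x ρ).val : ℝ) else 0) +
          if ρ = ν then (m μ ν : ℝ) *
            ((((QuantumFieldTheory.Site.shift x ν) ν).val : ℝ) - ((x ν).val : ℝ)) else 0 := by
    intro ρ
    by_cases hρ : ρ = ν
    · subst hρ
      rw [if_pos hμν, if_pos hμν, if_pos rfl]
      ring
    · rw [if_neg hρ, flux_shift_apply_ne x hρ, add_zero]
  rw [Finset.sum_congr rfl fun ρ _ => key ρ]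
  simp only [Finset.sum_add_distrib, Finset.sum_ite_eq', Finset.mem_univ, if_true]

/-! ### The plaquette phase of Lüscher's field (`μ < ν`) -/

/-- **The signed sum of Lüscher's four phases around a plaquette is `2π m_{μν}/L²` modulo `2π`
(`μ < ν`).**  With `φ(x,μ) = −(2π/L²)[ L·δ_{x̃_μ,L−1}·Σ_{ρ>μ} m_{μρ} x̃_ρ + Σ_{ρ<μ} m_{μρ} x̃_ρ ]`:
`φ(x,μ) + φ(x+μ̂,ν) − φ(x+ν̂,μ) − φ(x,ν) = (2π m_{μν}/L²)·(Δ_μ(x) + L·δ_{x̃_μ,L−1}·Δ_ν(x))`, which is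
`2π m_{μν}/L²` unless `x̃_μ = x̃_ν = L − 1` (the wrap corner), where it is `2π m_{μν}/L² − 2π m_{μν}`. -/
theorem flux_phase_plaquette (L : ℕ) [NeZero L] (m : Fin 4 → Fin 4 → ℤ)
    (hm : ∀ μ ν, m ν μ = -m μ ν) (x : TorusSite 4 L) {μ ν : Fin 4} (hμν : μ < ν) :
    ∃ k : ℤ,
      -(2 * Real.pi / (L : ℝ) ^ 2) *
            ((L : ℝ) * (if (x μ).val = L - 1 then 1 else 0) *
                (∑ ρ : Fin 4, if μ < ρ then (m μ ρ : ℝ) * ((x ρ).val : ℝ) else 0) +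
              ∑ ρ : Fin 4, if ρ < μ then (m μ ρ : ℝ) * ((x ρ).val : ℝ) else 0) +
          -(2 * Real.pi / (L : ℝ) ^ 2) *
            ((L : ℝ) * (if ((QuantumFieldTheory.Site.shift x μ) ν).val = L - 1 then 1 else 0) *
                (∑ ρ : Fin 4, if ν < ρ then
                  (m ν ρ : ℝ) * (((QuantumFieldTheory.Site.shift x μ) ρ).val : ℝ) else 0) +
              ∑ ρ : Fin 4, if ρ < ν then
                (m ν ρ : ℝ) * (((QuantumFieldTheory.Site.shift x μ) ρ).val : ℝ) else 0) +
          -(-(2 * Real.pi / (L : ℝ) ^ 2) *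
            ((L : ℝ) * (if ((QuantumFieldTheory.Site.shift x ν) μ).val = L - 1 then 1 else 0) *
                (∑ ρ : Fin 4, if μ < ρ then
                  (m μ ρ : ℝ) * (((QuantumFieldTheory.Site.shift x ν) ρ).val : ℝ) else 0) +
              ∑ ρ : Fin 4, if ρ < μ then
                (m μ ρ : ℝ) * (((QuantumFieldTheory.Site.shift x ν) ρ).val : ℝ) else 0)) +
          -(-(2 * Real.pi / (L : ℝ) ^ 2) *
            ((L : ℝ) * (if (x ν).val = L - 1 then 1 else 0) *
                (∑ ρ : Fin 4, if ν < ρ then (m ν ρ : ℝ) * ((x ρ).val : ℝ) else 0) +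
              ∑ ρ : Fin 4, if ρ < ν then (m ν ρ : ℝ) * ((x ρ).val : ℝ) else 0)) =
        2 * Real.pi * (m μ ν : ℝ) / (L : ℝ) ^ 2 + k * (2 * Real.pi) := by
  -- the sums and seam indicators at the two shifted sites, in terms of those at `x`
  rw [flux_sumHi_shift_lo m x hμν, flux_sumLo_shift_lo m x hμν, flux_sumHi_shift_hi m x hμν,
    flux_sumLo_shift_hi m x hμν, flux_shift_apply_ne x (ne_of_gt hμν),
    flux_shift_apply_ne x (ne_of_lt hμν), hm μ ν, Int.cast_neg]
  have hL : (L : ℝ) ≠ 0 := Nat.cast_ne_zero.2 (NeZero.ne L)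
  by_cases hμs : (x μ).val = L - 1
  · rw [flux_jump_of_eq x μ hμs, if_pos hμs]
    by_cases hνs : (x ν).val = L - 1
    · -- the wrap corner
      refine ⟨-(m μ ν), ?_⟩
      rw [flux_jump_of_eq x ν hνs, Int.cast_neg]
      field_simp
      ring
    · refine ⟨0, ?_⟩
      rw [flux_jump_of_ne x ν hνs, Int.cast_zero, zero_mul, add_zero]
      ring
  · refine ⟨0, ?_⟩
    rw [flux_jump_of_ne x μ hμs, if_neg hμs, Int.cast_zero, zero_mul, add_zero]
    ring

/-! ### Holonomies of a `Circle`-valued field with prescribed plaquette phases -/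

/-- Reversing the orientation of a plaquette inverts its holonomy (any group). -/
theorem flux_plaquetteHolonomy_swap {d L : ℕ} {G : Type*} [Group G] (U : GaugeConfig d L G)
    (x : TorusSite d L) (μ ν : Fin d) :
    plaquetteHolonomy U x μ ν = (plaquetteHolonomy U x ν μ)⁻¹ := by
  simp only [plaquetteHolonomy, mul_inv_rev, inv_inv, mul_assoc]

/-- A degenerate plaquette (`μ = ν`) has trivial holonomy (any group). -/
theorem flux_plaquetteHolonomy_self {d L : ℕ} {G : Type*} [Group G] (U : GaugeConfig d L G)
    (x : TorusSite d L) (μ : Fin d) : plaquetteHolonomy U x μ μ = 1 := by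
  simp only [plaquetteHolonomy, mul_inv_cancel_right, mul_inv_cancel]

/-- **Holonomies of a phase field.**  If the phases `φ : sites × directions → ℝ` of a `U(1)` field
`V(x,μ) = exp(i φ(x,μ))` satisfy `φ(x,μ) + φ(x+μ̂,ν) − φ(x+ν̂,μ) − φ(x,ν) ≡ 2π m_{μν}/L² (mod 2π)`
for all `μ < ν`, with `m` antisymmetric, then the holonomy of `V` around every plaquette `(x, μ, ν)`
is `exp(2πi m_{μν}/L²)` (`μ = ν`: both sides are `1`; `μ > ν`: the inverse of `(x, ν, μ)`). -/
theorem flux_plaquette_of_phase {L : ℕ} (m : Fin 4 → Fin 4 → ℤ) (hm : ∀ μ ν, m ν μ = -m μ ν)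
    (φ : TorusSite 4 L → Fin 4 → ℝ)
    (hφ : ∀ (x : TorusSite 4 L) (μ ν : Fin 4), μ < ν → ∃ k : ℤ,
      φ x μ + φ (QuantumFieldTheory.Site.shift x μ) ν + -φ (QuantumFieldTheory.Site.shift x ν) μ +
          -φ x ν = 2 * Real.pi * (m μ ν : ℝ) / (L : ℝ) ^ 2 + k * (2 * Real.pi))
    (x : TorusSite 4 L) (μ ν : Fin 4) :
    plaquetteHolonomy (fun e : TorusSite 4 L × Fin 4 => Circle.exp (φ e.1 e.2)) x μ ν =
      Circle.exp (2 * Real.pi * (m μ ν : ℝ) / (L : ℝ) ^ 2) := by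
  -- the ordered planes first
  have hlt : ∀ {μ ν : Fin 4}, μ < ν →
      plaquetteHolonomy (fun e : TorusSite 4 L × Fin 4 => Circle.exp (φ e.1 e.2)) x μ ν =
        Circle.exp (2 * Real.pi * (m μ ν : ℝ) / (L : ℝ) ^ 2) := by
    intro μ ν hμν
    simp only [plaquetteHolonomy]
    rw [← Circle.exp_neg, ← Circle.exp_neg, ← Circle.exp_add, ← Circle.exp_add, ← Circle.exp_add]
    exact Circle.exp_eq_exp.2 (hφ x μ ν hμν)
  rcases lt_trichotomy μ ν with h | rfl | h
  · exact hlt h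
  · have h0 : (m μ μ : ℝ) = 0 := by
      have h := hm μ μ
      have : m μ μ = 0 := by omega
      simp [this]
    rw [flux_plaquetteHolonomy_self, h0, mul_zero, zero_div, Circle.exp_zero]
  · rw [flux_plaquetteHolonomy_swap, hlt h, ← Circle.exp_neg, hm ν μ]
    congr 1
    push_cast
    ring

/-- **Helper `flux_plaquette_fluxSector` (S11): plaquettes of Lüscher's flux-sector field.**
For an antisymmetric integer matrix `m` and the periodic four-torus `(ℤ/Lℤ)⁴`, the `U(1)` field
`V(x,μ) = exp{ −(2πi/L²)[ L·δ_{x̃_μ,L−1}·Σ_{ν>μ} m_{μν} x̃_ν + Σ_{ν<μ} m_{μν} x̃_ν ] }`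
(M. Lüscher, Nucl. Phys. B 549 (1999) 295, §7; `x̃ ∈ {0,…,L−1}⁴` the coordinates) has constant
field tensor: its holonomy around every plaquette `(x, μ, ν)` equals `exp(2πi m_{μν}/L²)`
(for `μ = ν` both sides are `1`, and `μ > ν` is the inverse of `ν < μ`). -/
theorem flux_plaquette_fluxSector :
    ∀ (L : ℕ) [NeZero L] (m : Fin 4 → Fin 4 → ℤ), (∀ μ ν, m ν μ = -m μ ν) →
      ∀ (x : TorusSite 4 L) (μ ν : Fin 4),
        plaquetteHolonomy
            (fun e : TorusSite 4 L × Fin 4 => Circle.exp (-(2 * Real.pi / (L : ℝ) ^ 2) *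
              ((L : ℝ) * (if (e.1 e.2).val = L - 1 then 1 else 0) *
                  (∑ ν : Fin 4, if e.2 < ν then (m e.2 ν : ℝ) * ((e.1 ν).val : ℝ) else 0) +
                ∑ ν : Fin 4, if ν < e.2 then (m e.2 ν : ℝ) * ((e.1 ν).val : ℝ) else 0)))
            x μ ν =
          Circle.exp (2 * Real.pi * (m μ ν : ℝ) / (L : ℝ) ^ 2) := by
  intro L _ m hm x μ ν
  exact flux_plaquette_of_phase m hm
    (fun (y : TorusSite 4 L) (σ : Fin 4) => -(2 * Real.pi / (L : ℝ) ^ 2) *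
      ((L : ℝ) * (if (y σ).val = L - 1 then 1 else 0) *
          (∑ ν : Fin 4, if σ < ν then (m σ ν : ℝ) * ((y ν).val : ℝ) else 0) +
        ∑ ν : Fin 4, if ν < σ then (m σ ν : ℝ) * ((y ν).val : ℝ) else 0))
    (fun y σ τ h => flux_phase_plaquette L m hm y h) x μ ν

/-- **Helper `flux_norm_one_sub_circleExp_le` (S11): the chord is shorter than the arc.**
`‖1 − e^{iθ}‖ = 2|sin(θ/2)| ≤ |θ|` for every real `θ`. -/
theorem flux_norm_one_sub_circleExp_le :
    ∀ θ : ℝ, ‖(1 : ℂ) - ((Circle.exp θ : Circle) : ℂ)‖ ≤ |θ| := by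
  intro θ
  rw [norm_sub_rev, Circle.coe_exp, mul_comm, ← Real.norm_eq_abs]
  exact Real.norm_exp_I_mul_ofReal_sub_one_le

end Summit.QuantumFields.QCD.Cruxes.WindowExtinction.FreeVolumeHeavyWitness

end
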